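import Summits.ResolutionOfSingularities.ResolutionOfSingularities.Theorems.EquisingularLiftEquisingularLiftNatNoseTowerBTriplePrimeSigmaPGOfFact
import Summits.ResolutionOfSingularities.ResolutionOfSingularities.Theorems.EquisingularLiftEquisingularLiftNatResidueHypDefsE8
import Summits.ResolutionOfSingularities.ResolutionOfSingularities.Theorems.EquisingularLiftEquisingularLiftNatLiftNoseSectionsStage
import HarnessLib

/-!
# [OURS · L1 W4.5(b) · EL♮(3) · WIDTH TABLE D15 «ν-LIFT DOOR», engine (E2a)] THE HSUBⁱ SUPPLIER AT THE ν-LIFT DOOR ★ `LiftNose.hsublift_of_door`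
# and the ΣPG-tail composite `LiftNose.liftNose_stage_zero_of_letters_sigmaPG` (the rung ★★ `nose_lift_rung_three` = RUNG^{ΣPG} + this arm lives in `…NatNoseLiftRung`)

res-L1-w45b-nose-w1 g7 (WIDTH seat D-0157 DOOR 1; desk RULING R78 (iii) 2026-08-29T10:25:06Z: «ENGINE (nose-w1 g7, scratch → file as imports turn ✓): (E1)
`…NatLiftNoseSectionsStage` → (E2) `LiftNose.hsublift_of_door` + ★`nose_lift_rung_three` … module `Theorems/…NatNoseLiftRung.lean`»).  Door text of record =
res-type-027 g24 DefsE8 rev2 13df6c5f9a65277c (`NoseLift₀` · `ReachLiftNoseSigmaPG₂` · blob E8; the (z4) letter per this seat's by-type Q).  Consumed by the rung `nose_lift_rung_three` =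
res-L1-w45b-stub-2's RUNG^{ΣPG} `nose_secpg_rung_three` (…NatNosePGRung) with ONE more `Or.elim` arm (module `…NatNoseLiftRung`).  OURS; NOT a statement of any manuscript ([Hironaka2017] is a candidate
under adjudication, nothing of it is asserted); AI-written, weaker than expert review.  No `sorry`; standard axioms; DEF-FREE; the ONLY named hypothesis
is (T-k) `EmbeddedCurveLiftFact` (the registered `stub_elnat_embeddedCurveLiftFact`).  `--supports stmt-ResolutionOfSingularities-20148 --as helper`,
counted 0.  EL♮(3) is NOT proved here: after the D15 REPLACE the nose residue reads `¬ NoseHypHostedNestEquinodalDirectCILiftSigmaPGBTriplePrime₂`;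
resolution of singularities in positive characteristic is NOT proved anywhere in this tree (dim 3 in print: Cossart–Piltant 2008/2009).
[folklore; pure composition of ✓ modules]
-/

set_option linter.dupNamespace false -- mandated namespace `Summit.<Summit>.<Problem>` of this single-conjunct summit
set_option linter.overlappingInstances false -- signatures carry `[IsDomain O] [IsDiscreteValuationRing O]`

noncomputable section

open CategoryTheory CategoryTheory.Limits AlgebraicGeometry TopologicalSpace Topology IsLocalRing
open MvPolynomial
open Literature.AlgebraicGeometry.Resolution
open AlgebraicGeometry.Scheme.IdealSheafData
open Summit.ResolutionOfSingularities.ResolutionOfSingularities.Theses.EquisingularLift.Split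
open Summit.ResolutionOfSingularities.ResolutionOfSingularities.Cruxes.EquisingularLift.StrataSplit

namespace Summit.ResolutionOfSingularities.ResolutionOfSingularities.Cruxes.EquisingularLiftNat.Sections.LiftNose

/-- ★ **THE ν-LIFT NOSE MOVE AT THE INITIAL STAGE OVER THE ΣPG TAIL, keyed to the door's letters** (D15 engine (E2)): ✓ `liftNose_stage_zero_of_letters`
(…NatLiftNoseSectionsStage) with the B‴ 3-rule tail replaced by the D15 door's 5-rule ΣPG tail and the Σ-licence `hSL` threaded to res-L1-w45b-stub-2's (3′)
`Equinodal.noseRound_stage_of_model_sigmaPG` (the (P-ram-Γ) licence is inside ✓ `Tower.towerPRamGamma_invB₁_FE`).  (z1)(z2)(z3) derived, (z4) = the door letter.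
[OURS · L1 W4.5b · D15 engine (E2); counted 0; EL♮(3) NOT proved] -/
theorem liftNose_stage_zero_of_letters_sigmaPG (hF : EmbeddedCurveLiftFact) (k : Type) [Field k] [IsAlgClosed k] (H : Scheme.{0})
    (ι : H ⟶ (Literature.AlgebraicGeometry.Motives.projectiveSpace 3 k).left)
    (hι : AlgebraicGeometry.IsClosedImmersion ι) (hH : AlgebraicGeometry.IsIntegral H)
    (O : Type) [CommRing O] [IsDomain O] [IsDiscreteValuationRing O] [IsAdicComplete (IsLocalRing.maximalIdeal O) O]
    [IsAlgClosed (IsLocalRing.ResidueField O)] (θ : O →+* k) (hθ : Function.Surjective θ)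
    -- the Σ-LICENCE at `(O, k, θ)` (res-L1-w45b-stub-2's binder 0196e0c85d2c112d; WIDTH TABLE D12)
    (hSL :
      ∀ {P : Scheme.{0}} (X : Scheme.{0}) (σ : X ⟶ P) (q : P ⟶ Spec (.of O)) (𝓔 : X.IdealSheafData),
        IsIntegral X → IsLocallyNoetherian X → Scheme.IsRegular X → IsProper (σ ≫ q) →
        (∀ x : X, (stalkIdeal 𝓔 x).IsPrincipal) → 𝓔 ≠ ⊥ →
        Scheme.IsRegular 𝓔.subscheme → Flat (𝓔.subschemeι ≫ σ ≫ q) → IsProper (𝓔.subschemeι ≫ σ ≫ q) →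
        ∀ (G : Scheme.{0}) (j : G ⟶ X) (t : G ⟶ Spec (.of k)),
          IsPullback j t (σ ≫ q) (Spec.map (CommRingCat.ofHom θ)) →
          ∀ (E : Set G) (hE : IsClosed E), 𝓔.comap j = vanishingIdeal (⟨E, hE⟩ : Closeds G) →
          ∀ (Z : Set G) (hZ : IsClosed Z), Z ⊆ E →
            Set.Finite {x : ↥(redSub G Z hZ) | ¬ IsRegularLocalRing ((redSub G Z hZ).presheaf.stalk x)} →
            (∀ z : ↥(redSub G Z hZ), IsClosed ({z} : Set ↥(redSub G Z hZ)) →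
              ringKrullDim ((redSub G Z hZ).presheaf.stalk z) = ((1 : ℕ) : WithBot ℕ∞)) →
            (∀ (i : redSub G Z hZ ⟶ redSub G E hE), i ≫ redSubι G E hE = redSubι G Z hZ →
              ∀ z : ↥(redSub G Z hZ), IsClosed ({z} : Set ↥(redSub G Z hZ)) →
                ringKrullDim ((redSub G E hE).presheaf.stalk (i z)) = ((2 : ℕ) : WithBot ℕ∞)) →
            (∀ z ∈ Z, IsClosed ({z} : Set G) → ∃ f : G.presheaf.stalk z,
              stalkIdeal (vanishingIdeal (⟨Z, hZ⟩ : Closeds G)) z =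
                  stalkIdeal (vanishingIdeal (⟨E, hE⟩ : Closeds G)) z ⊔ Ideal.span {f} ∧
                f ∉ stalkIdeal (vanishingIdeal (⟨E, hE⟩ : Closeds G)) z ⊔ (maximalIdeal (G.presheaf.stalk z)) ^ 2) →
            DirStepUnobs G E hE Z hZ →
            ∃ C : X.IdealSheafData, 𝓔 ≤ C ∧ Scheme.IsRegular C.subscheme ∧ Flat (C.subschemeι ≫ σ ≫ q) ∧
              C.comap j = vanishingIdeal (⟨Z, hZ⟩ : Closeds G)) :
    letI := MvPolynomial.gradedAlgebra (σ := Fin (3 + 1)) (R := O); letI := MvPolynomial.gradedAlgebra (σ := Fin (3 + 1)) (R := k);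
    ∀ (φ : MvPolynomial.homogeneousSubmodule (Fin (3 + 1)) O →+*ᵍ MvPolynomial.homogeneousSubmodule (Fin (3 + 1)) k)
      (hφ' : HomogeneousIdeal.irrelevant (MvPolynomial.homogeneousSubmodule (Fin (3 + 1)) k) ≤ (HomogeneousIdeal.irrelevant (MvPolynomial.homogeneousSubmodule (Fin (3 + 1)) O)).map φ), (∀ s, φ s = MvPolynomial.map θ s) →
    ∀ (Ch : ∀ X' : AlgebraicGeometry.Scheme.{0}, (X' ⟶ (AlgebraicGeometry.Proj (MvPolynomial.homogeneousSubmodule (Fin (3 + 1)) O))) → Set X' → Prop),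
      (∀ (X' X'' : AlgebraicGeometry.Scheme.{0}) (σ' : X' ⟶ (AlgebraicGeometry.Proj (MvPolynomial.homogeneousSubmodule (Fin (3 + 1)) O))) (S' : Set X') (C : X'.IdealSheafData) (τ : X'' ⟶ X'), Ch X' σ' S' → Literature.AlgebraicGeometry.Resolution.IsBlowup τ C →
        Literature.AlgebraicGeometry.Resolution.Scheme.IsRegular C.subscheme → AlgebraicGeometry.Flat (C.subschemeι ≫ σ' ≫ (AlgebraicGeometry.Proj.toSpecZero (MvPolynomial.homogeneousSubmodule (Fin (3 + 1)) O) ≫ AlgebraicGeometry.Spec.map (CommRingCat.ofHom (algebraMap O (MvPolynomial.homogeneousSubmodule (Fin (3 + 1)) O 0))))) → σ' '' (C.support : Set X') ⊆ {y | ¬ IsGenericPoint y (Set.range (ι ≫ AlgebraicGeometry.Proj.map φ hφ' : H ⟶ (AlgebraicGeometry.Proj (MvPolynomial.homogeneousSubmodule (Fin (3 + 1)) O))))} →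
        (C.support : Set X') ∩ (σ' ≫ (AlgebraicGeometry.Proj.toSpecZero (MvPolynomial.homogeneousSubmodule (Fin (3 + 1)) O) ≫ AlgebraicGeometry.Spec.map (CommRingCat.ofHom (algebraMap O (MvPolynomial.homogeneousSubmodule (Fin (3 + 1)) O 0))))) ⁻¹' {IsLocalRing.closedPoint O} ⊆ S' → Ch X'' (τ ≫ σ') (closure (τ ⁻¹' (S' \ (C.support : Set X'))))) → (∀ (X' : AlgebraicGeometry.Scheme.{0}) (σ' : X' ⟶ (AlgebraicGeometry.Proj (MvPolynomial.homogeneousSubmodule (Fin (3 + 1)) O))) (S' : Set X'), Ch X' σ' S' →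
        Summit.ResolutionOfSingularities.ResolutionOfSingularities.Theses.EquisingularLift.Split.Chain (AlgebraicGeometry.Proj (MvPolynomial.homogeneousSubmodule (Fin (3 + 1)) O)) (Set.range (ι ≫ AlgebraicGeometry.Proj.map φ hφ' : H ⟶ (AlgebraicGeometry.Proj (MvPolynomial.homogeneousSubmodule (Fin (3 + 1)) O)))) X' σ' S') → (Set.range (ι ≫ AlgebraicGeometry.Proj.map φ hφ' : H ⟶ (AlgebraicGeometry.Proj (MvPolynomial.homogeneousSubmodule (Fin (3 + 1)) O)))) ⊆ (AlgebraicGeometry.Proj.toSpecZero (MvPolynomial.homogeneousSubmodule (Fin (3 + 1)) O) ≫ AlgebraicGeometry.Spec.map (CommRingCat.ofHom (algebraMap O (MvPolynomial.homogeneousSubmodule (Fin (3 + 1)) O 0)))) ⁻¹' {IsLocalRing.closedPoint O} → IsIrreducible (Set.range (ι ≫ AlgebraicGeometry.Proj.map φ hφ' : H ⟶ (AlgebraicGeometry.Proj (MvPolynomial.homogeneousSubmodule (Fin (3 + 1)) O)))) → IsClosed (Set.range (ι ≫ AlgebraicGeometry.Proj.map φ hφ' : H ⟶ (AlgebraicGeometry.Proj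 (MvPolynomial.homogeneousSubmodule (Fin (3 + 1)) O)))) →
      AlgebraicGeometry.IsIntegral (AlgebraicGeometry.Proj (MvPolynomial.homogeneousSubmodule (Fin (3 + 1)) O)) → IsLocallyNoetherian (AlgebraicGeometry.Proj (MvPolynomial.homogeneousSubmodule (Fin (3 + 1)) O)) → Literature.AlgebraicGeometry.Resolution.Scheme.IsRegular (AlgebraicGeometry.Proj (MvPolynomial.homogeneousSubmodule (Fin (3 + 1)) O)) → AlgebraicGeometry.IsProper (AlgebraicGeometry.Proj.toSpecZero (MvPolynomial.homogeneousSubmodule (Fin (3 + 1)) O) ≫ AlgebraicGeometry.Spec.map (CommRingCat.ofHom (algebraMap O (MvPolynomial.homogeneousSubmodule (Fin (3 + 1)) O 0)))) → AlgebraicGeometry.SmoothOfRelativeDimension 3 (AlgebraicGeometry.Proj.toSpecZero (MvPolynomial.homogeneousSubmodule (Fin (3 + 1)) O) ≫ AlgebraicGeometry.Spec.map (CommRingCat.ofHom (algebraMap O (MvPolynomial.homogeneousSubmodule (Fin (3 + 1)) O 0)))) →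
      -- the INITIAL stage is in the chain
      Ch (AlgebraicGeometry.Proj (MvPolynomial.homogeneousSubmodule (Fin (3 + 1)) O)) (𝟙 (AlgebraicGeometry.Proj (MvPolynomial.homogeneousSubmodule (Fin (3 + 1)) O))) (Set.range (ι ≫ AlgebraicGeometry.Proj.map φ hφ' : H ⟶ (AlgebraicGeometry.Proj (MvPolynomial.homogeneousSubmodule (Fin (3 + 1)) O)))) →
    -- the door's NOSE `Z ⊆ range ι` (`range ι ⊄ Z`, infinite) and its FINITE closed point set `S ⊆ Z` (door letters; `S = ∅` allowed)
    ∀ (Z : Set (Literature.AlgebraicGeometry.Motives.projectiveSpace 3 k).left) (hZ : IsClosed Z), Z ⊆ Set.range ι → ¬ (Set.range ι ⊆ Z) → Z.Infinite →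
    ∀ (S : Set (Literature.AlgebraicGeometry.Motives.projectiveSpace 3 k).left) (hS : IsClosed S), S ⊆ Z → S.Finite →
    -- the PRESCRIBED SECTIONS `𝓢` (the slot's first half)
    ∀ (𝓢 : (AlgebraicGeometry.Proj (MvPolynomial.homogeneousSubmodule (Fin (3 + 1)) O)).IdealSheafData),
      Literature.AlgebraicGeometry.Resolution.Scheme.IsRegular 𝓢.subscheme →
      AlgebraicGeometry.Flat (𝓢.subschemeι ≫ (AlgebraicGeometry.Proj.toSpecZero (MvPolynomial.homogeneousSubmodule (Fin (3 + 1)) O) ≫ AlgebraicGeometry.Spec.map (CommRingCat.ofHom (algebraMap O (MvPolynomial.homogeneousSubmodule (Fin (3 + 1)) O 0))))) →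
      𝓢.comap (AlgebraicGeometry.Proj.map φ hφ') = vanishingIdeal (⟨S, hS⟩ : Closeds (Literature.AlgebraicGeometry.Motives.projectiveSpace 3 k).left) →
    -- the downstairs blow-up of `𝓘⟨S⟩`
    ∀ (F₂ : Scheme.{0}) (υ : F₂ ⟶ (Literature.AlgebraicGeometry.Motives.projectiveSpace 3 k).left),
      IsBlowup υ (vanishingIdeal (⟨S, hS⟩ : Closeds (Literature.AlgebraicGeometry.Motives.projectiveSpace 3 k).left)) →
    -- ONE letter at the new stage: the CURVE CLAUSE for the strict transform `Z₂ := closure (υ ⁻¹' (Z ∖ S))` (the other three nose letters are derived)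
      (∀ z : ↥(redSub F₂ (closure (υ ⁻¹' (Z \ S))) isClosed_closure), IsClosed ({z} : Set ↥(redSub F₂ (closure (υ ⁻¹' (Z \ S))) isClosed_closure)) →
        ringKrullDim ((redSub F₂ (closure (υ ⁻¹' (Z \ S))) isClosed_closure).presheaf.stalk z) = ((1 : ℕ) : WithBot ℕ∞)) →
    -- the SLOT's second half: on every blow-up of `𝓢`, over every model square of `υ`, a regular `O`-flat centre with reduced trace `closure (υ ⁻¹' (Z ∖ S))`
      (∀ (X₁ : Scheme.{0}) (τ : X₁ ⟶ (AlgebraicGeometry.Proj (MvPolynomial.homogeneousSubmodule (Fin (3 + 1)) O))), IsBlowup τ 𝓢 →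
        ∀ (j₁ : F₂ ⟶ X₁) (t₁ : F₂ ⟶ Spec (.of k)),
          IsPullback j₁ t₁ (τ ≫ (AlgebraicGeometry.Proj.toSpecZero (MvPolynomial.homogeneousSubmodule (Fin (3 + 1)) O) ≫ AlgebraicGeometry.Spec.map (CommRingCat.ofHom (algebraMap O (MvPolynomial.homogeneousSubmodule (Fin (3 + 1)) O 0))))) (Spec.map (CommRingCat.ofHom θ)) →
          j₁ ≫ τ = υ ≫ AlgebraicGeometry.Proj.map φ hφ' →
          ∃ C : X₁.IdealSheafData, Scheme.IsRegular C.subscheme ∧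
            Flat (C.subschemeι ≫ τ ≫ (AlgebraicGeometry.Proj.toSpecZero (MvPolynomial.homogeneousSubmodule (Fin (3 + 1)) O) ≫ AlgebraicGeometry.Spec.map (CommRingCat.ofHom (algebraMap O (MvPolynomial.homogeneousSubmodule (Fin (3 + 1)) O 0))))) ∧
            C.comap j₁ = vanishingIdeal (⟨closure (υ ⁻¹' (Z \ S)), isClosed_closure⟩ : Closeds F₂)) →
    -- THE MOVE: the nose blow-up at the new stage and the B‴ tail (door clauses verbatim at `(F₂, T₂, Z₂)`)
    ∀ (F₃ : Scheme.{0}) (υ' : F₃ ⟶ F₂), IsBlowup υ' (vanishingIdeal (⟨closure (υ ⁻¹' (Z \ S)), isClosed_closure⟩ : Closeds F₂)) →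
    ∀ (F₉ : Scheme.{0}) (γ' : F₉ ⟶ F₃) (T₉ E' : Set F₉) (Es' Ns' : List (Set F₉)) (K' : Set F₉),
      (∀ R : (∀ G : Scheme.{0}, (G ⟶ F₃) → Set G → Set G → List (Set G) → List (Set G) → Set G → Prop),
        R F₃ (𝟙 F₃) (closure (υ' ⁻¹' ((closure (υ ⁻¹' (Set.range ι \ S))) \ (closure (υ ⁻¹' (Z \ S)))))) (υ' ⁻¹' (closure (υ ⁻¹' (Z \ S)))) [] [] ∅ →
        TowerPtRegB₄ F₃ R → TowerPtRamB₄ F₃ R → TowerRoundBTriplePrime F₂ F₃ υ' (closure (υ ⁻¹' (Z \ S))) isClosed_closure R →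
        TowerSecRoundSigma F₂ F₃ υ' (closure (υ ⁻¹' (Z \ S))) isClosed_closure R →
        TowerPRamGamma F₂ F₃ υ' (closure (υ ⁻¹' (Z \ S))) isClosed_closure R →
        R F₉ γ' T₉ E' Es' Ns' K') →
    ∃ (X₉ : Scheme.{0}) (σ₉ : X₉ ⟶ (AlgebraicGeometry.Proj (MvPolynomial.homogeneousSubmodule (Fin (3 + 1)) O))) (S₉ : Set X₉) (j₉ : F₉ ⟶ X₉) (t₉ : F₉ ⟶ AlgebraicGeometry.Spec (.of k)),
      Ch X₉ σ₉ S₉ ∧ AlgebraicGeometry.IsIntegral X₉ ∧ IsLocallyNoetherian X₉ ∧ Literature.AlgebraicGeometry.Resolution.Scheme.IsRegular X₉ ∧ AlgebraicGeometry.IsDominant (σ₉ ≫ (AlgebraicGeometry.Proj.toSpecZero (MvPolynomial.homogeneousSubmodule (Fin (3 + 1)) O) ≫ AlgebraicGeometry.Spec.map (CommRingCat.ofHom (algebraMap O (MvPolynomial.homogeneousSubmodule (Fin (3 + 1)) O 0))))) ∧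
      IsPullback j₉ t₉ (σ₉ ≫ (AlgebraicGeometry.Proj.toSpecZero (MvPolynomial.homogeneousSubmodule (Fin (3 + 1)) O) ≫ AlgebraicGeometry.Spec.map (CommRingCat.ofHom (algebraMap O (MvPolynomial.homogeneousSubmodule (Fin (3 + 1)) O 0))))) (AlgebraicGeometry.Spec.map (CommRingCat.ofHom θ)) ∧ j₉ '' T₉ = S₉ ∧ IsClosed T₉ ∧ IsIrreducible T₉ ∧ AlgebraicGeometry.IsIntegral F₉ ∧
      TCPlus.LetterDatum O (AlgebraicGeometry.Proj (MvPolynomial.homogeneousSubmodule (Fin (3 + 1)) O)) (AlgebraicGeometry.Proj.toSpecZero (MvPolynomial.homogeneousSubmodule (Fin (3 + 1)) O) ≫ AlgebraicGeometry.Spec.map (CommRingCat.ofHom (algebraMap O (MvPolynomial.homogeneousSubmodule (Fin (3 + 1)) O 0)))) (Set.range (ι ≫ AlgebraicGeometry.Proj.map φ hφ' : H ⟶ (AlgebraicGeometry.Proj (MvPolynomial.homogeneousSubmodule (Fin (3 + 1)) O)))) F₉ X₉ σ₉ j₉ (∅ : Set F₉) := by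
  classical
  letI := MvPolynomial.gradedAlgebra (σ := Fin (3 + 1)) (R := O)
  letI := MvPolynomial.gradedAlgebra (σ := Fin (3 + 1)) (R := k)
  intro φ hφ' hφ Ch hChStep hChSplit hYsp hYirr hYcl hPint hPnoeth hPreg hqprop hqsm hCh₀ Z hZ hZT hTZ hZinf S hS hSZ hSfin 𝓢 h𝓢reg h𝓢fl h𝓢tr F₂ υ hυ
    hZ₂dim hslot F₃ υ' hυ' F₉ γ' T₉ E' Es' Ns' K' htail
  -- the support of `𝓘⟨S⟩` is `S`; the blow-up `υ` is onto off `S`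
  have hsuppS : (((vanishingIdeal (⟨S, hS⟩ : Closeds (Literature.AlgebraicGeometry.Motives.projectiveSpace 3 k).left)) :
      (Literature.AlgebraicGeometry.Motives.projectiveSpace 3 k).left.IdealSheafData).support :
        Set (Literature.AlgebraicGeometry.Motives.projectiveSpace 3 k).left) = S :=
    Scheme.IdealSheafData.coe_support_vanishingIdeal _
  have hlift : ∀ y : (Literature.AlgebraicGeometry.Motives.projectiveSpace 3 k).left, y ∉ S → ∃ y₂ : F₂, υ y₂ = y := by
    intro y hy
    exact hυ.exists_preimage_of_notMem_support (by rw [← hsuppS] at hy; exact hy)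
  -- (z1) `Z₂ ⊆ T₂`
  have hZ₂T : (closure (υ ⁻¹' (Z \ S))) ⊆ (closure (υ ⁻¹' (Set.range ι \ S))) :=
    closure_mono (Set.preimage_mono (Set.sdiff_subset_sdiff_left hZT))
  -- (z2) `¬ T₂ ⊆ Z₂`: a point of `range ι ∖ Z` lifts into `T₂` and off `υ ⁻¹' Z ⊇ Z₂`
  have hZ₂sub : (closure (υ ⁻¹' (Z \ S))) ⊆ υ ⁻¹' Z := closure_minimal (fun z hz => hz.1) (hZ.preimage υ.continuous)
  have hT₂Z : ¬ ((closure (υ ⁻¹' (Set.range ι \ S))) ⊆ (closure (υ ⁻¹' (Z \ S)))) := by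
    obtain ⟨t, htT, htZ⟩ := Set.not_subset.mp hTZ
    obtain ⟨t₂, ht₂⟩ := hlift t (fun h => htZ (hSZ h))
    intro hsub
    have h1 : t₂ ∈ (closure (υ ⁻¹' (Set.range ι \ S))) := subset_closure (by rw [Set.mem_preimage, ht₂]; exact ⟨htT, fun h => htZ (hSZ h)⟩)
    have h2 := hZ₂sub (hsub h1)
    rw [Set.mem_preimage, ht₂] at h2
    exact htZ h2
  -- (z3) `Z₂` is infinite: `υ '' υ ⁻¹' (Z ∖ S) = Z ∖ S` is infinite (`S` finite)
  have hZ₂inf : (closure (υ ⁻¹' (Z \ S))).Infinite := by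
    intro hfin
    apply (hZinf.sdiff hSfin)
    refine ((hfin.subset subset_closure).image υ).subset ?_
    intro y hy
    obtain ⟨y₂, hy₂⟩ := hlift y hy.2
    exact ⟨y₂, by rw [Set.mem_preimage, hy₂]; exact hy, hy₂⟩
  -- the SECTIONS STEP (✓ `sectionsStep_stage_zero_of_model`): the chain stage at `Bl_𝓢 ℙ³_O` over `F₂` carrying the slot's centre of `Z₂` …
  have hmodel := sectionsStep_stage_zero_of_model k H ι hι hH O θ hθ φ hφ' hφ Ch hChStep hChSplit hYsp hYirr hYcl hPint hPnoeth hPreg hCh₀ S hS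
    (hSZ.trans hZT) (fun h => hTZ (h.trans hSZ)) 𝓢 h𝓢reg h𝓢fl h𝓢tr F₂ υ hυ (closure (υ ⁻¹' (Z \ S))) isClosed_closure hslot
  -- … then PHASE 2 with the ΣPG tail (res-L1-w45b-stub-2 (3′) `Equinodal.noseRound_stage_of_model_sigmaPG`)
  exact Equinodal.noseRound_stage_of_model_sigmaPG hF k O θ hθ hSL _ _ _ Ch hChStep hChSplit hYsp hYirr hYcl hPint hPnoeth hPreg hqprop hqsm
    F₂ (closure (υ ⁻¹' (Set.range ι \ S))) (closure (υ ⁻¹' (Z \ S))) isClosed_closure hZ₂T hT₂Z hZ₂inf hZ₂dim hmodel F₃ υ' hυ' F₉ γ' T₉ E' Es' Ns' K' htail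

/-- ★ **HSUBⁱ AT THE ν-LIFT DOOR `ReachLiftNoseSigmaPG₂ k 3 H ι (range ι)`** (D15 engine (E2); statement = ✓ `Direct.hsubci_sigmaPG_of_smoothing`'s with the
door token swapped): unpack the door (res-type-027 DefsE8: `Z`, the door-owned finite point set `S ⊆` image of the non-regular locus of `Z̃` — whence
`S ⊆ Z`, `S` finite by (N1) —, the SLOT `NoseLift₀ k 3 H ι Z hZ S hS`, the downstairs blow-ups `υ`, `υ'`, the strict transform's curve clause (z4), the ΣPG
tail), evaluate the slot at `(O, θ, φ)` (its «off generic Y» conjuncts are dropped — the engine re-derives them from the chain) and run the composite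
`liftNose_stage_zero_of_letters_sigmaPG`; the host letter is dropped (`LetterDatum … ∅`, `E₉ = ∅`). [OURS · L1 W4.5b · D15 engine (E2); EL♮(3) NOT proved] -/
theorem hsublift_of_door (hF : EmbeddedCurveLiftFact) (k : Type) [Field k] [IsAlgClosed k] (H : Scheme.{0})
    (ι : H ⟶ (Literature.AlgebraicGeometry.Motives.projectiveSpace 3 k).left)
    (hι : AlgebraicGeometry.IsClosedImmersion ι) (hH : AlgebraicGeometry.IsIntegral H)
    (E₀ : Set (Literature.AlgebraicGeometry.Motives.projectiveSpace 3 k).left) :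
    ∀ (O : Type) [CommRing O] [IsDomain O] [IsDiscreteValuationRing O] [IsAdicComplete (IsLocalRing.maximalIdeal O) O] [IsAlgClosed (IsLocalRing.ResidueField O)] (θ : O →+* k), Function.Surjective θ →
      -- the Σ-LICENCE at `(O, k, θ)` (res-L1-w45b-stub-2's binder 0196e0c85d2c112d; WIDTH TABLE D12)
      (∀ {P : Scheme.{0}} (X : Scheme.{0}) (σ : X ⟶ P) (q : P ⟶ Spec (.of O)) (𝓔 : X.IdealSheafData),
        IsIntegral X → IsLocallyNoetherian X → Scheme.IsRegular X → IsProper (σ ≫ q) →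
        (∀ x : X, (stalkIdeal 𝓔 x).IsPrincipal) → 𝓔 ≠ ⊥ →
        Scheme.IsRegular 𝓔.subscheme → Flat (𝓔.subschemeι ≫ σ ≫ q) → IsProper (𝓔.subschemeι ≫ σ ≫ q) →
        ∀ (G : Scheme.{0}) (j : G ⟶ X) (t : G ⟶ Spec (.of k)),
          IsPullback j t (σ ≫ q) (Spec.map (CommRingCat.ofHom θ)) →
          ∀ (E : Set G) (hE : IsClosed E), 𝓔.comap j = vanishingIdeal (⟨E, hE⟩ : Closeds G) →
          ∀ (Z : Set G) (hZ : IsClosed Z), Z ⊆ E →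
            Set.Finite {x : ↥(redSub G Z hZ) | ¬ IsRegularLocalRing ((redSub G Z hZ).presheaf.stalk x)} →
            (∀ z : ↥(redSub G Z hZ), IsClosed ({z} : Set ↥(redSub G Z hZ)) →
              ringKrullDim ((redSub G Z hZ).presheaf.stalk z) = ((1 : ℕ) : WithBot ℕ∞)) →
            (∀ (i : redSub G Z hZ ⟶ redSub G E hE), i ≫ redSubι G E hE = redSubι G Z hZ →
              ∀ z : ↥(redSub G Z hZ), IsClosed ({z} : Set ↥(redSub G Z hZ)) →
                ringKrullDim ((redSub G E hE).presheaf.stalk (i z)) = ((2 : ℕ) : WithBot ℕ∞)) →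
            (∀ z ∈ Z, IsClosed ({z} : Set G) → ∃ f : G.presheaf.stalk z,
              stalkIdeal (vanishingIdeal (⟨Z, hZ⟩ : Closeds G)) z =
                  stalkIdeal (vanishingIdeal (⟨E, hE⟩ : Closeds G)) z ⊔ Ideal.span {f} ∧
                f ∉ stalkIdeal (vanishingIdeal (⟨E, hE⟩ : Closeds G)) z ⊔ (maximalIdeal (G.presheaf.stalk z)) ^ 2) →
            DirStepUnobs G E hE Z hZ →
            ∃ C : X.IdealSheafData, 𝓔 ≤ C ∧ Scheme.IsRegular C.subscheme ∧ Flat (C.subschemeι ≫ σ ≫ q) ∧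
              C.comap j = vanishingIdeal (⟨Z, hZ⟩ : Closeds G)) →
      (letI := MvPolynomial.gradedAlgebra (σ := Fin (3 + 1)) (R := O); letI := MvPolynomial.gradedAlgebra (σ := Fin (3 + 1)) (R := k);
       ∀ (φ : MvPolynomial.homogeneousSubmodule (Fin (3 + 1)) O →+*ᵍ MvPolynomial.homogeneousSubmodule (Fin (3 + 1)) k)
        (hφ' : HomogeneousIdeal.irrelevant (MvPolynomial.homogeneousSubmodule (Fin (3 + 1)) k) ≤ (HomogeneousIdeal.irrelevant (MvPolynomial.homogeneousSubmodule (Fin (3 + 1)) O)).map φ), (∀ s, φ s = MvPolynomial.map θ s) →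
      ∀ (Ch : ∀ X' : AlgebraicGeometry.Scheme.{0}, (X' ⟶ (AlgebraicGeometry.Proj (MvPolynomial.homogeneousSubmodule (Fin (3 + 1)) O))) → Set X' → Prop),
        (∀ (X' X'' : AlgebraicGeometry.Scheme.{0}) (σ' : X' ⟶ (AlgebraicGeometry.Proj (MvPolynomial.homogeneousSubmodule (Fin (3 + 1)) O))) (S' : Set X') (C : X'.IdealSheafData) (τ : X'' ⟶ X'), Ch X' σ' S' → Literature.AlgebraicGeometry.Resolution.IsBlowup τ C →
          Literature.AlgebraicGeometry.Resolution.Scheme.IsRegular C.subscheme → AlgebraicGeometry.Flat (C.subschemeι ≫ σ' ≫ (AlgebraicGeometry.Proj.toSpecZero (MvPolynomial.homogeneousSubmodule (Fin (3 + 1)) O) ≫ AlgebraicGeometry.Spec.map (CommRingCat.ofHom (algebraMap O (MvPolynomial.homogeneousSubmodule (Fin (3 + 1)) O 0))))) → σ' '' (C.support : Set X') ⊆ {y | ¬ IsGenericPoint y (Set.range (ι ≫ AlgebraicGeometry.Proj.map φ hφ' : H ⟶ (AlgebraicGeometry.Proj (MvPolynomial.homogeneousSubmodule (Fin (3 + 1))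 O))))} →
          (C.support : Set X') ∩ (σ' ≫ (AlgebraicGeometry.Proj.toSpecZero (MvPolynomial.homogeneousSubmodule (Fin (3 + 1)) O) ≫ AlgebraicGeometry.Spec.map (CommRingCat.ofHom (algebraMap O (MvPolynomial.homogeneousSubmodule (Fin (3 + 1)) O 0))))) ⁻¹' {IsLocalRing.closedPoint O} ⊆ S' → Ch X'' (τ ≫ σ') (closure (τ ⁻¹' (S' \ (C.support : Set X'))))) → (∀ (X' : AlgebraicGeometry.Scheme.{0}) (σ' : X' ⟶ (AlgebraicGeometry.Proj (MvPolynomial.homogeneousSubmodule (Fin (3 + 1)) O))) (S' : Set X'), Ch X' σ' S' →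
          Summit.ResolutionOfSingularities.ResolutionOfSingularities.Theses.EquisingularLift.Split.Chain (AlgebraicGeometry.Proj (MvPolynomial.homogeneousSubmodule (Fin (3 + 1)) O)) (Set.range (ι ≫ AlgebraicGeometry.Proj.map φ hφ' : H ⟶ (AlgebraicGeometry.Proj (MvPolynomial.homogeneousSubmodule (Fin (3 + 1)) O)))) X' σ' S') → (Set.range (ι ≫ AlgebraicGeometry.Proj.map φ hφ' : H ⟶ (AlgebraicGeometry.Proj (MvPolynomial.homogeneousSubmodule (Fin (3 + 1)) O)))) ⊆ (AlgebraicGeometry.Proj.toSpecZero (MvPolynomial.homogeneousSubmodule (Fin (3 + 1)) O) ≫ AlgebraicGeometry.Spec.map (CommRingCat.ofHom (algebraMap O (MvPolynomial.homogeneousSubmodule (Fin (3 + 1)) O 0)))) ⁻¹' {IsLocalRing.closedPoint O} → IsIrreducible (Set.range (ι ≫ AlgebraicGeometry.Proj.map φ hφ' : H ⟶ (AlgebraicGeometry.Proj (MvPolynomial.homogeneousSubmodule (Fin (3 + 1)) O)))) → IsClosed (Set.range (ι ≫ AlgebraicGeometry.Proj.map φ hφ' : H ⟶ (AlgebraicGeometry.Proj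 (MvPolynomial.homogeneousSubmodule (Fin (3 + 1)) O)))) →
        AlgebraicGeometry.IsIntegral (AlgebraicGeometry.Proj (MvPolynomial.homogeneousSubmodule (Fin (3 + 1)) O)) → IsLocallyNoetherian (AlgebraicGeometry.Proj (MvPolynomial.homogeneousSubmodule (Fin (3 + 1)) O)) → Literature.AlgebraicGeometry.Resolution.Scheme.IsRegular (AlgebraicGeometry.Proj (MvPolynomial.homogeneousSubmodule (Fin (3 + 1)) O)) → AlgebraicGeometry.IsProper (AlgebraicGeometry.Proj.toSpecZero (MvPolynomial.homogeneousSubmodule (Fin (3 + 1)) O) ≫ AlgebraicGeometry.Spec.map (CommRingCat.ofHom (algebraMap O (MvPolynomial.homogeneousSubmodule (Fin (3 + 1)) O 0)))) → AlgebraicGeometry.SmoothOfRelativeDimension 3 (AlgebraicGeometry.Proj.toSpecZero (MvPolynomial.homogeneousSubmodule (Fin (3 + 1)) O) ≫ AlgebraicGeometry.Spec.map (CommRingCat.ofHom (algebraMap O (MvPolynomial.homogeneousSubmodule (Fin (3 + 1)) O 0)))) →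
      -- the INITIAL stage and the initial host's model
      Ch (AlgebraicGeometry.Proj (MvPolynomial.homogeneousSubmodule (Fin (3 + 1)) O)) (𝟙 (AlgebraicGeometry.Proj (MvPolynomial.homogeneousSubmodule (Fin (3 + 1)) O))) (Set.range (ι ≫ AlgebraicGeometry.Proj.map φ hφ' : H ⟶ (AlgebraicGeometry.Proj (MvPolynomial.homogeneousSubmodule (Fin (3 + 1)) O)))) →
      TCPlus.LetterDatum O (AlgebraicGeometry.Proj (MvPolynomial.homogeneousSubmodule (Fin (3 + 1)) O)) (AlgebraicGeometry.Proj.toSpecZero (MvPolynomial.homogeneousSubmodule (Fin (3 + 1)) O) ≫ AlgebraicGeometry.Spec.map (CommRingCat.ofHom (algebraMap O (MvPolynomial.homogeneousSubmodule (Fin (3 + 1)) O 0)))) (Set.range (ι ≫ AlgebraicGeometry.Proj.map φ hφ' : H ⟶ (AlgebraicGeometry.Proj (MvPolynomial.homogeneousSubmodule (Fin (3 + 1)) O)))) (Literature.AlgebraicGeometry.Motives.projectiveSpace 3 k).left (AlgebraicGeometry.Proj (MvPolynomial.homogeneousSubmodule (Fin (3 + 1)) O)) (𝟙 (AlgebraicGeometry.Proj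 (MvPolynomial.homogeneousSubmodule (Fin (3 + 1)) O))) (AlgebraicGeometry.Proj.map φ hφ' : (Literature.AlgebraicGeometry.Motives.projectiveSpace 3 k).left ⟶ (AlgebraicGeometry.Proj (MvPolynomial.homogeneousSubmodule (Fin (3 + 1)) O))) E₀ →
      ∀ (ℓ : MvPolynomial (Fin (3 + 1)) k) (F₉ : AlgebraicGeometry.Scheme.{0}) (β : F₉ ⟶ (Literature.AlgebraicGeometry.Motives.projectiveSpace 3 k).left) (T₉ E₉ : Set F₉),
        E₀ = {y : (Literature.AlgebraicGeometry.Motives.projectiveSpace 3 k).left | ℓ ∈ (y : ProjectiveSpectrum (MvPolynomial.homogeneousSubmodule (Fin (3 + 1)) k)).asHomogeneousIdeal} →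
        ReachLiftNoseSigmaPG₂ k 3 H ι (Set.range ι) F₉ β T₉ E₉ →
        ∃ (X₉ : AlgebraicGeometry.Scheme.{0}) (σ₉ : X₉ ⟶ (AlgebraicGeometry.Proj (MvPolynomial.homogeneousSubmodule (Fin (3 + 1)) O))) (S₉ : Set X₉) (j₉ : F₉ ⟶ X₉) (t₉ : F₉ ⟶ AlgebraicGeometry.Spec (.of k)),
          Ch X₉ σ₉ S₉ ∧ AlgebraicGeometry.IsIntegral X₉ ∧ IsLocallyNoetherian X₉ ∧ Literature.AlgebraicGeometry.Resolution.Scheme.IsRegular X₉ ∧ AlgebraicGeometry.IsDominant (σ₉ ≫ (AlgebraicGeometry.Proj.toSpecZero (MvPolynomial.homogeneousSubmodule (Fin (3 + 1)) O) ≫ AlgebraicGeometry.Spec.map (CommRingCat.ofHom (algebraMap O (MvPolynomial.homogeneousSubmodule (Fin (3 + 1)) O 0))))) ∧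
          IsPullback j₉ t₉ (σ₉ ≫ (AlgebraicGeometry.Proj.toSpecZero (MvPolynomial.homogeneousSubmodule (Fin (3 + 1)) O) ≫ AlgebraicGeometry.Spec.map (CommRingCat.ofHom (algebraMap O (MvPolynomial.homogeneousSubmodule (Fin (3 + 1)) O 0))))) (AlgebraicGeometry.Spec.map (CommRingCat.ofHom θ)) ∧ j₉ '' T₉ = S₉ ∧ IsClosed T₉ ∧ IsIrreducible T₉ ∧ AlgebraicGeometry.IsIntegral F₉ ∧
          TCPlus.LetterDatum O (AlgebraicGeometry.Proj (MvPolynomial.homogeneousSubmodule (Fin (3 + 1)) O)) (AlgebraicGeometry.Proj.toSpecZero (MvPolynomial.homogeneousSubmodule (Fin (3 + 1)) O) ≫ AlgebraicGeometry.Spec.map (CommRingCat.ofHom (algebraMap O (MvPolynomial.homogeneousSubmodule (Fin (3 + 1)) O 0)))) (Set.range (ι ≫ AlgebraicGeometry.Proj.map φ hφ' : H ⟶ (AlgebraicGeometry.Proj (MvPolynomial.homogeneousSubmodule (Fin (3 + 1)) O)))) F₉ X₉ σ₉ j₉ E₉)   := by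
  classical
  intro O _ _ _ _ _ θ hθ hSL
  letI := MvPolynomial.gradedAlgebra (σ := Fin (3 + 1)) (R := O)
  letI := MvPolynomial.gradedAlgebra (σ := Fin (3 + 1)) (R := k)
  intro φ hφ' hφ Ch hChStep hChSplit hYsp hYirr hYcl hPint hPnoeth hPreg hqprop hqsm hCh₀ _h𝓔₀ ℓ F₉ β T₉ E₉ _hE hR
  obtain ⟨hE₉, Z, hZ, hZT, hTZ, hZinf, _hZdim, hN1, S, hS, hSsub, hLift, F₂, υ, hυ, hZ₂dim, F₃, υ', hυ', γ', E', Es', Ns', K', htail, -⟩ := hR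
  subst hE₉
  -- the door-owned point set: `S ⊆ Z` (points of `Z̃`) and `S` is FINITE ((N1))
  have hSZ : S ⊆ Z := by
    intro y hy
    obtain ⟨z, -, rfl⟩ := hSsub hy
    have h1 : (redSubι (Literature.AlgebraicGeometry.Motives.projectiveSpace 3 k).left Z hZ z :
        (Literature.AlgebraicGeometry.Motives.projectiveSpace 3 k).left) ∈ Set.range (redSubι (Literature.AlgebraicGeometry.Motives.projectiveSpace 3 k).left Z hZ) :=
      ⟨z, rfl⟩
    rw [Scheme.IdealSheafData.range_subschemeι, Scheme.IdealSheafData.coe_support_vanishingIdeal] at h1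
    exact h1
  have hSfin : S.Finite :=
    (hN1.image fun z => (redSubι (Literature.AlgebraicGeometry.Motives.projectiveSpace 3 k).left Z hZ z :
      (Literature.AlgebraicGeometry.Motives.projectiveSpace 3 k).left)).subset fun y hy => by
      obtain ⟨z, hz, rfl⟩ := hSsub hy
      exact ⟨z, hz, rfl⟩
  -- THE SLOT at `(O, θ, φ)`: the prescribed sections `𝓢` and the centre promise on their blow-up (the «off generic Y» conjuncts are not read)
  obtain ⟨𝓢, h𝓢reg, h𝓢fl, h𝓢tr, -, hC⟩ := hLift O θ hθ φ hφ' hφ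
  -- the move upstairs: the sections step + PHASE 2 with the ΣPG tail (`liftNose_stage_zero_of_letters_sigmaPG`)
  exact liftNose_stage_zero_of_letters_sigmaPG hF k H ι hι hH O θ hθ hSL φ hφ' hφ Ch hChStep hChSplit hYsp hYirr hYcl hPint hPnoeth hPreg hqprop hqsm hCh₀
    Z hZ hZT hTZ hZinf S hS hSZ hSfin 𝓢 h𝓢reg h𝓢fl h𝓢tr F₂ υ hυ hZ₂dim
    (fun X₁ τ hτ j₁ t₁ hsq hcomm => by
      obtain ⟨C, hCreg, hCfl, hCj, -⟩ := hC X₁ τ hτ F₂ υ hυ j₁ t₁ hsq hcomm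
      exact ⟨C, hCreg, hCfl, hCj⟩)
    F₃ υ' hυ' F₉ γ' T₉ E' Es' Ns' K' htail

end Summit.ResolutionOfSingularities.ResolutionOfSingularities.Cruxes.EquisingularLiftNat.Sections.LiftNose

end
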